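import Summits.ValiantsHypothesis.ValiantsHypothesis.Theorems.LacunarySymmetroidMatrixDescartesCensusDoorA34SheetHiddenDefinite

/-!
# `MatrixDescartes` census — DOOR A at `(3,4)`: the DEFINITE-LETTER NAPPE LAW (sign corollary of Gårding's reverse Cauchy–Schwarz for `X ↦ tr(adj X·P)`,
# `P ≻ 0`) and its NAPPE TEST on the semidefinite cell of the null-top sheet, where the definite letter is a HIDDEN one

HONEST FRAMING.  Object-search cell `pub-symmetroid`, engine seat `val-sym-eng-2` (g5); helper rows beside the registered strata line
`Cruxes/DoorA34/Lines/strata.lean` on stmt-ValiantsHypothesis-19980 (`DoorA34 = PosRootLawAt 3 4 18`: OPEN, typed, never asserted here).  Fifth file of the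
seat.  `…CensusGardingLorentz.garding_row_N3` is the MAGNITUDE row `4 q_P(X) q_P(Y) ≤ m_P(X,Y)²` for a definite letter `P`; its SIGN corollary — the two
nappes of the Lorentzian cone `{q_P > 0}` are told apart by the linear functional `T_P(X) = tr(adj P·X)` — was not in the kernel:

* `trace_adjugate_mul_nonpos_of_polar_eq_zero` — `P ≻ 0`, `Z` symmetric, `tr(adj P·Z) = 0 ⇒ tr(adj Z·P) ≤ 0` (congruence to `P = 1`, where it is
  `trace_adjugate_nonpos_of_trace_zero`);
* **`definite_letter_nappe_law`** (`P ≻ 0`) / `…_neg` (`P ≺ 0`): `q_P(X) > 0 ∧ q_P(Y) > 0 ⇒ 0 < T_P(X)·T_P(Y)·m_P(X,Y)` — in slot currency, for a definite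
  letter `S_x` of sign `s` and two other letters `y, z` (the singular `S₃` allowed): `s c_{xyy} > 0 ∧ s c_{xzz} > 0 ⇒ s·c_{xxy}·c_{xxz}·c_{xyz} > 0`;
* **`card_posRoots_le_17_of_semidef_nappeTest`** (`S₃ ⪰ 0`; `…_neg` for `S₃ ⪯ 0`) — decidable chamber test: orientation `(−1)^{ρ(2d_x+d₃)} det S₀ > 0`,
  `x` hidden-definite (`ρ(3d_x) ≡ ρ(2d₃+d_x)`), and parities making the nappe law fail for a pair `{y, z}` ⇒ `Z₊ ≤ 17`; instances on `(0,3,8,17)`,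
  `(0,6,10,19)` (`S₃ ⪰ 0` side) and `(0,6,8,13)`, `(0,7,16,20)` (`S₃ ⪯ 0` side) — the last undecided classes of the seat's atlas.

LOCATED (seat atlas, report HOME/DOOR-A34-ENG2G5-REPORT.md): with this law the sign-level theory {rank parity, sheet pair law, hidden types, edge tests, nappe
law} DECIDES ALL `160` oriented semidefinite chamber classes of the null-top sheet (`39 + 45` killed, `41 + 35` realised by exact rational symmetric letters,
`0` contradictions), while the INDEFINITE cell is realised on `80/80` chambers.  Nothing here bounds anything else; `DoorA34` and the three stubs stay OPEN;
registers unchanged; nothing on `MatrixDescartes` (stmt-ValiantsHypothesis-18050) or `VP ≠ VNP` — VP≠VNP not moved.  [folklore] Gårding / Lorentzian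
two-nappe argument; elementary.
-/

-- `Summit.ValiantsHypothesis.ValiantsHypothesis.…` repeats a component by the D-0017 layout
-- (single-conjunct summit), which the `dupNamespace` linter flags; the name is mandated.
set_option linter.dupNamespace false

namespace Summit.ValiantsHypothesis.ValiantsHypothesis.Theorems.LacunarySymmetroidMatrixDescartes.Census

open Polynomial Finset Matrix
open scoped BigOperators Polynomial Matrix

/-! ## 1. The nappe law for a definite letter -/

/-- `tr(adj(MMᵀ)·(M Z Mᵀ)) = (det M)²·tr Z`. [folklore] -/
theorem trace_adjugate_mul_transpose_mul_congr (M Z : Matrix (Fin 3) (Fin 3) ℝ) :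
    ((M * Mᵀ).adjugate * (M * Z * Mᵀ)).trace = M.det ^ 2 * Z.trace := by
  rw [Matrix.adjugate_mul_distrib]
  have h1 : Mᵀ.adjugate * M.adjugate * (M * Z * Mᵀ) = M.det • (Mᵀ.adjugate * Z * Mᵀ) := by
    rw [Matrix.mul_assoc Mᵀ.adjugate, ← Matrix.mul_assoc M.adjugate, ← Matrix.mul_assoc M.adjugate, Matrix.adjugate_mul,
      Matrix.smul_mul, Matrix.one_mul, Matrix.smul_mul, Matrix.mul_smul, Matrix.mul_assoc]
  rw [h1, Matrix.trace_smul, Matrix.trace_mul_cycle, Matrix.mul_adjugate, det_transpose, Matrix.smul_mul, Matrix.one_mul,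
    Matrix.trace_smul, smul_eq_mul, smul_eq_mul]
  ring

/-- **The polar hyperplane of a definite letter is spacelike**: `P ≻ 0`, `Z` symmetric with `tr(adj P·Z) = 0` ⇒ `tr(adj Z·P) ≤ 0`. [folklore] -/
theorem trace_adjugate_mul_nonpos_of_polar_eq_zero {P Z : Matrix (Fin 3) (Fin 3) ℝ} (hP : P.PosDef) (hZ : Z.IsSymm)
    (h0 : (P.adjugate * Z).trace = 0) : (Z.adjugate * P).trace ≤ 0 := by
  obtain ⟨M, hM, rfl⟩ := exists_mul_transpose_of_posDef hP
  have hMu : IsUnit M.det := isUnit_iff_ne_zero.2 hM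
  have hMT : IsUnit Mᵀ.det := by rw [det_transpose]; exact hMu
  obtain ⟨Z', hZ', rfl⟩ : ∃ Z' : Matrix (Fin 3) (Fin 3) ℝ, Z'.IsSymm ∧ Z = M * Z' * Mᵀ := by
    refine ⟨M⁻¹ * Z * Mᵀ⁻¹, ?_, ?_⟩
    · unfold Matrix.IsSymm
      rw [transpose_mul, transpose_mul, ← transpose_nonsing_inv, transpose_transpose, hZ.eq, transpose_nonsing_inv, Matrix.mul_assoc]
    · calc Z = (M * M⁻¹) * Z * (Mᵀ⁻¹ * Mᵀ) := by
            rw [Matrix.mul_nonsing_inv M hMu, Matrix.nonsing_inv_mul Mᵀ hMT, Matrix.one_mul, Matrix.mul_one]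
        _ = M * (M⁻¹ * Z * Mᵀ⁻¹) * Mᵀ := by simp only [Matrix.mul_assoc]
  rw [trace_adjugate_mul_transpose_mul_congr] at h0
  have htr : Z'.trace = 0 := by
    have hd : M.det ^ 2 ≠ 0 := pow_ne_zero 2 hM
    exact (mul_eq_zero.mp h0).resolve_left hd
  rw [trace_adjugate_congr]
  exact mul_nonpos_of_nonneg_of_nonpos (sq_nonneg _) (trace_adjugate_nonpos_of_trace_zero hZ' htr)
    |> fun h => by nlinarith [h, sq_nonneg M.det, trace_adjugate_nonpos_of_trace_zero hZ' htr]

/-- The polar functional `T_P(W) = tr(adj P·W)` along `s•B − t•A`. [folklore] -/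
theorem trace_adjugate_mul_sub_smul (P A B : Matrix (Fin 3) (Fin 3) ℝ) (s t : ℝ) :
    (P.adjugate * (s • B - t • A)).trace = s * (P.adjugate * B).trace - t * (P.adjugate * A).trace := by
  rw [Matrix.mul_sub, Matrix.mul_smul, Matrix.mul_smul, Matrix.trace_sub, Matrix.trace_smul, Matrix.trace_smul, smul_eq_mul, smul_eq_mul]

/-- The basic two-nappe inequality for a definite letter: `T(Y)² q(X) + T(X)² q(Y) ≤ T(X) T(Y) m(X,Y)`. [folklore] -/
theorem definite_polarised_cone_inequality {P X Y : Matrix (Fin 3) (Fin 3) ℝ} (hP : P.PosDef) (hX : X.IsSymm) (hY : Y.IsSymm) :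
    (P.adjugate * Y).trace ^ 2 * (X.adjugate * P).trace + (P.adjugate * X).trace ^ 2 * (Y.adjugate * P).trace
      ≤ (P.adjugate * X).trace * (P.adjugate * Y).trace * (((X + Y).adjugate - X.adjugate - Y.adjugate) * P).trace := by
  have hZ : (((P.adjugate * Y).trace) • X - ((P.adjugate * X).trace) • Y).IsSymm := (hX.smul _).sub (hY.smul _)
  have h0 : (P.adjugate * (((P.adjugate * Y).trace) • X - ((P.adjugate * X).trace) • Y)).trace = 0 := by
    rw [trace_adjugate_mul_sub_smul]; ring
  have hle := trace_adjugate_mul_nonpos_of_polar_eq_zero hP hZ h0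
  rw [trace_adjugate_sub_smul_mul, add_comm Y X, sub_right_comm] at hle
  linarith

/-- **DEFINITE-LETTER NAPPE LAW (`P ≻ 0`).**  `X, Y` symmetric with `q_P(X) = tr(adj X·P) > 0` and `q_P(Y) > 0` ⇒
`0 < tr(adj P·X)·tr(adj P·Y)·tr((adj(X+Y) − adj X − adj Y)·P)`: two timelike letters lie in the same nappe iff their polar values have the same sign.
In slot currency (`P = S_x ≻ 0`): `c_{xyy} > 0 ∧ c_{xzz} > 0 ⇒ c_{xxy}·c_{xxz}·c_{xyz} > 0`. [folklore] -/
theorem definite_letter_nappe_law {P X Y : Matrix (Fin 3) (Fin 3) ℝ} (hP : P.PosDef) (hX : X.IsSymm) (hY : Y.IsSymm)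
    (hqX : 0 < (X.adjugate * P).trace) (hqY : 0 < (Y.adjugate * P).trace) :
    0 < (P.adjugate * X).trace * (P.adjugate * Y).trace * (((X + Y).adjugate - X.adjugate - Y.adjugate) * P).trace := by
  have hTX : (P.adjugate * X).trace ≠ 0 := fun h =>
    absurd (trace_adjugate_mul_nonpos_of_polar_eq_zero hP hX h) (not_le.mpr hqX)
  have hle := definite_polarised_cone_inequality hP hX hY
  set TX := (P.adjugate * X).trace
  set TY := (P.adjugate * Y).trace
  have h1 : 0 < TX ^ 2 * (Y.adjugate * P).trace := mul_pos (by positivity) hqY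
  have h2 : 0 ≤ TY ^ 2 * (X.adjugate * P).trace := mul_nonneg (sq_nonneg _) hqX.le
  linarith

/-- For `3 × 3` matrices `adj(−P) = adj P` (local copy). [folklore] -/
private theorem adjugate_neg_aux' (P : Matrix (Fin 3) (Fin 3) ℝ) : (-P).adjugate = P.adjugate := by
  rw [← neg_one_smul ℝ P, Matrix.adjugate_smul]; simp

/-- **DEFINITE-LETTER NAPPE LAW (`P ≺ 0`)**: `q_P(X) < 0 ∧ q_P(Y) < 0 ⇒ tr(adj P·X)·tr(adj P·Y)·m_P(X,Y) < 0`. [folklore] -/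
theorem definite_letter_nappe_law_neg {P X Y : Matrix (Fin 3) (Fin 3) ℝ} (hP : (-P).PosDef) (hX : X.IsSymm) (hY : Y.IsSymm)
    (hqX : (X.adjugate * P).trace < 0) (hqY : (Y.adjugate * P).trace < 0) :
    (P.adjugate * X).trace * (P.adjugate * Y).trace * (((X + Y).adjugate - X.adjugate - Y.adjugate) * P).trace < 0 := by
  have hqX' : 0 < (X.adjugate * (-P)).trace := by rw [Matrix.mul_neg, Matrix.trace_neg]; linarith
  have hqY' : 0 < (Y.adjugate * (-P)).trace := by rw [Matrix.mul_neg, Matrix.trace_neg]; linarith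
  have law := definite_letter_nappe_law hP hX hY hqX' hqY'
  rw [adjugate_neg_aux', Matrix.mul_neg, Matrix.trace_neg] at law
  linarith

/-! ## 2. The NAPPE TEST on a hypothetical null-top eighteen (semidefinite cell) -/

/-- **NAPPE TEST (`S₃ ⪰ 0`).**  Sheet rank `ρ`; orientation `(−1)^{ρ(2d_x+d₃)} det S₀ > 0` (`c_{3xx} > 0`); `x` hidden-definite (`ρ(3d_x) ≡ ρ(2d₃+d_x)`);
two further letters `y ≠ z` (both `≠ x`; the top letter allowed) with `c_{xyy}`, `c_{xzz}` of the sign of `c_{33x}` (`ρ(2d₃+d_x) ≡ ρ(2d_y+d_x) ≡ ρ(2d_z+d_x)`)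
but `c_{33x}·c_{xxy}·c_{xxz}·c_{xyz} < 0` (`ρ(2d₃+d_x)+ρ(2d_x+d_y)+ρ(2d_x+d_z)+ρ(d_y+d_z+d_x)` odd) — against the nappe law, so `Z₊ ≤ 17`. [folklore] -/
theorem card_posRoots_le_17_of_semidef_nappeTest (d : Fin 4 → ℕ) (hd : StrictMono d) (S : Fin 4 → Matrix (Fin 3) (Fin 3) ℝ)
    (hS : ∀ l, (S l).IsSymm) (h3 : (S 3).det = 0) (hpsd : (S 3).PosSemidef)
    (ρ : ℕ → ℕ) (hρ : ∀ e, ρ e = ((((Finset.univ : Finset (Sym (Fin 4) 3)).erase (Sym.replicate 3 3)).image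
          (fun s : Sym (Fin 4) 3 => ((s : Multiset (Fin 4)).map d).sum)).filter (· < e)).card)
    {x y z : Fin 4} (hx : x ≠ 3) (hyx : y ≠ x) (hzx : z ≠ x) (hyz : y ≠ z)
    (hor : 0 < (-1 : ℝ) ^ ρ (2 * d x + d 3) * (S 0).det)
    (hxdef : (ρ (3 * d x) + ρ (2 * d 3 + d x)) % 2 = 0)
    (hqy : (ρ (2 * d 3 + d x) + ρ (2 * d y + d x)) % 2 = 0) (hqz : (ρ (2 * d 3 + d x) + ρ (2 * d z + d x)) % 2 = 0)
    (hm : (ρ (2 * d 3 + d x) + ρ (2 * d x + d y) + (ρ (2 * d x + d z) + ρ (d y + d z + d x))) % 2 = 1) :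
    ((Matrix.det (∑ l, ((X : ℝ[X]) ^ d l) • (S l).map C)).roots.toFinset.filter (fun t => 0 < t)).card ≤ 17 := by
  by_contra hlt
  have h18 : 18 ≤ ((Matrix.det (∑ l, ((X : ℝ[X]) ^ d l) • (S l).map C)).roots.toFinset.filter (fun t => 0 < t)).card := by omega
  have hρ' : ∀ e, ρ e = ((Matrix.det (∑ l, ((X : ℝ[X]) ^ d l) • (S l).map C)).support.filter (· < e)).card := fun e => by
    rw [hρ, sheetRank_eq_of_nullTop_eighteen d S h3 h18]
  have hqx := middle_square_pos_of_orientation d hd S h3 h18 hx ρ hρ' hor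
  obtain ⟨hxd, hxiff⟩ := hiddenDefinite_of_parity d hd S hS h3 hpsd h18 hx ρ hρ' hqx hxdef
  obtain ⟨cTx, mTx⟩ := coeff_square_of_nullTop_eighteen d hd S h3 h18 3 x hx.symm
  obtain ⟨cqy, mqy⟩ := coeff_square_of_nullTop_eighteen d hd S h3 h18 y x hyx
  obtain ⟨cqz, mqz⟩ := coeff_square_of_nullTop_eighteen d hd S h3 h18 z x hzx
  obtain ⟨cTy, mTy⟩ := coeff_square_of_nullTop_eighteen d hd S h3 h18 x y hyx.symm
  obtain ⟨cTz, mTz⟩ := coeff_square_of_nullTop_eighteen d hd S h3 h18 x z hzx.symm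
  obtain ⟨cm, mm⟩ := coeff_mixed_of_nullTop_eighteen d hd S h3 h18 y z x hyz hyx hzx
  -- signs relative to `c_{33x}`
  have ry := (coeff_mul_coeff_sign_of_nullTop_eighteen d S h3 h18 mTx mqy).1 (by rw [← hρ', ← hρ']; exact hqy)
  have rz := (coeff_mul_coeff_sign_of_nullTop_eighteen d S h3 h18 mTx mqz).1 (by rw [← hρ', ← hρ']; exact hqz)
  rw [cTx, cqy] at ry; rw [cTx, cqz] at rz
  have r1 := coeff_mul_coeff_sign_of_nullTop_eighteen d S h3 h18 mTx mTy
  have r2 := coeff_mul_coeff_sign_of_nullTop_eighteen d S h3 h18 mTz mm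
  rw [cTx, cTy, ← hρ', ← hρ'] at r1; rw [cTz, cm, ← hρ', ← hρ'] at r2
  have hneg : ((S 3).adjugate * S x).trace
      * (((S x).adjugate * S y).trace * ((S x).adjugate * S z).trace * (((S y + S z).adjugate - (S y).adjugate - (S z).adjugate) * S x).trace) < 0 := by
    rcases Nat.mod_two_eq_zero_or_one (ρ (2 * d 3 + d x) + ρ (2 * d x + d y)) with p1 | p1 <;>
    rcases Nat.mod_two_eq_zero_or_one (ρ (2 * d x + d z) + ρ (d y + d z + d x)) with p2 | p2
    · exfalso; omega
    · nlinarith [r1.1 p1, r2.2 p2]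
    · nlinarith [r1.2 p1, r2.1 p2]
    · exfalso; omega
  have hTx := trace_adjugate_mul_ne_zero_of_nullTop_eighteen d hd S h3 h18 3 x hx.symm
  rcases lt_or_gt_of_ne hTx with hn | hp
  · -- `S_x ≺ 0`
    have hN : (-S x).PosDef := by
      rcases hxd with h | h
      · exact absurd (hxiff.mp h) (not_lt.mpr hn.le)
      · exact h
    have law := definite_letter_nappe_law_neg hN (hS y) (hS z) (by nlinarith [ry, hn]) (by nlinarith [rz, hn])
    nlinarith [law, hn, hneg]
  · have hPx : (S x).PosDef := hxiff.mpr hp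
    have law := definite_letter_nappe_law hPx (hS y) (hS z) (by nlinarith [ry, hp]) (by nlinarith [rz, hp])
    nlinarith [law, hp, hneg]

/-- **NAPPE TEST (`S₃ ⪯ 0`)**: the same parities with the orientation `(−1)^{ρ(2d_x+d₃)} det S₀ < 0` (by `S ↦ −S`). [folklore] -/
theorem card_posRoots_le_17_of_semidef_nappeTest_neg (d : Fin 4 → ℕ) (hd : StrictMono d) (S : Fin 4 → Matrix (Fin 3) (Fin 3) ℝ)
    (hS : ∀ l, (S l).IsSymm) (h3 : (S 3).det = 0) (hnsd : (-(S 3)).PosSemidef)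
    (ρ : ℕ → ℕ) (hρ : ∀ e, ρ e = ((((Finset.univ : Finset (Sym (Fin 4) 3)).erase (Sym.replicate 3 3)).image
          (fun s : Sym (Fin 4) 3 => ((s : Multiset (Fin 4)).map d).sum)).filter (· < e)).card)
    {x y z : Fin 4} (hx : x ≠ 3) (hyx : y ≠ x) (hzx : z ≠ x) (hyz : y ≠ z)
    (hor : (-1 : ℝ) ^ ρ (2 * d x + d 3) * (S 0).det < 0)
    (hxdef : (ρ (3 * d x) + ρ (2 * d 3 + d x)) % 2 = 0)
    (hqy : (ρ (2 * d 3 + d x) + ρ (2 * d y + d x)) % 2 = 0) (hqz : (ρ (2 * d 3 + d x) + ρ (2 * d z + d x)) % 2 = 0)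
    (hm : (ρ (2 * d 3 + d x) + ρ (2 * d x + d y) + (ρ (2 * d x + d z) + ρ (d y + d z + d x))) % 2 = 1) :
    ((Matrix.det (∑ l, ((X : ℝ[X]) ^ d l) • (S l).map C)).roots.toFinset.filter (fun t => 0 < t)).card ≤ 17 := by
  have hdet : ∀ l, ((fun l => -S l) l).det = -(S l).det := fun l => by
    simp only [Matrix.det_neg, Fintype.card_fin]; norm_num
  have h := card_posRoots_le_17_of_semidef_nappeTest d hd (fun l => -S l) (fun l => (hS l).neg) (by rw [hdet, h3, neg_zero]) hnsd ρ hρ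
    hx hyx hzx hyz (by rw [hdet, mul_neg]; exact neg_pos.mpr hor) hxdef hqy hqz hm
  rwa [posRoots_pencil_neg_three] at h

/-! ## 3. Instances: the four chambers of the seat's atlas decided by the nappe law alone -/

/-- The `19` sheet exponents of `(0, 3, 8, 17)`. [folklore] -/
theorem sheetExponents_0_3_8_17 :
    (((Finset.univ : Finset (Sym (Fin 4) 3)).erase (Sym.replicate 3 3)).image
        (fun s : Sym (Fin 4) 3 => ((s : Multiset (Fin 4)).map (![0, 3, 8, 17] : Fin 4 → ℕ)).sum))
      = ({0, 3, 6, 8, 9, 11, 14, 16, 17, 19, 20, 23, 24, 25, 28, 33, 34, 37, 42} : Finset ℕ) := by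
  decide

/-- **`(0, 3, 8, 17)`, S₃ ⪰ 0 ∧ det S₀ > 0 ⇒ `Z₊ ≤ 17`** (nappe test: hidden-definite letter `0`, pair `{1, 3}`; ranks by `decide`). [folklore] -/
theorem card_posRoots_le_17_of_semidef_nappeTest_on_0_3_8_17 (S : Fin 4 → Matrix (Fin 3) (Fin 3) ℝ) (hS : ∀ l, (S l).IsSymm)
    (h3 : (S 3).det = 0) (hpsd : (S 3).PosSemidef) (hor : 0 < (S 0).det) :
    ((Matrix.det (∑ l, ((X : ℝ[X]) ^ ((![0, 3, 8, 17] : Fin 4 → ℕ) l) • (S l).map C))).roots.toFinset.filter (fun t => 0 < t)).card ≤ 17 := by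
  have hd : StrictMono (![0, 3, 8, 17] : Fin 4 → ℕ) := by
    refine Fin.strictMono_iff_lt_succ.2 fun j => ?_
    fin_cases j <;> decide
  have hρ : ((({0, 3, 6, 8, 9, 11, 14, 16, 17, 19, 20, 23, 24, 25, 28, 33, 34, 37, 42} : Finset ℕ)).filter (· < 2 * (![0, 3, 8, 17] : Fin 4 → ℕ) 0 + (![0, 3, 8, 17] : Fin 4 → ℕ) 3)).card = 8 := by
    decide
  refine card_posRoots_le_17_of_semidef_nappeTest _ hd S hS h3 hpsd (fun e => ((({0, 3, 6, 8, 9, 11, 14, 16, 17, 19, 20, 23, 24, 25, 28, 33, 34, 37, 42} : Finset ℕ)).filter (· < e)).card) (fun e => by rw [sheetExponents_0_3_8_17])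
    (x := 0) (y := 1) (z := 3) (by decide) (by decide) (by decide) (by decide) ?_ (by decide) (by decide) (by decide) (by decide)
  rw [hρ]; norm_num; exact hor

/-- The `19` sheet exponents of `(0, 6, 10, 19)`. [folklore] -/
theorem sheetExponents_0_6_10_19 :
    (((Finset.univ : Finset (Sym (Fin 4) 3)).erase (Sym.replicate 3 3)).image
        (fun s : Sym (Fin 4) 3 => ((s : Multiset (Fin 4)).map (![0, 6, 10, 19] : Fin 4 → ℕ)).sum))
      = ({0, 6, 10, 12, 16, 18, 19, 20, 22, 25, 26, 29, 30, 31, 35, 38, 39, 44, 48} : Finset ℕ) := by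
  decide

/-- **`(0, 6, 10, 19)`, S₃ ⪰ 0 ∧ det S₀ > 0 ⇒ `Z₊ ≤ 17`** (nappe test: hidden-definite letter `2`, pair `{0, 1}`; ranks by `decide`). [folklore] -/
theorem card_posRoots_le_17_of_semidef_nappeTest_on_0_6_10_19 (S : Fin 4 → Matrix (Fin 3) (Fin 3) ℝ) (hS : ∀ l, (S l).IsSymm)
    (h3 : (S 3).det = 0) (hpsd : (S 3).PosSemidef) (hor : 0 < (S 0).det) :
    ((Matrix.det (∑ l, ((X : ℝ[X]) ^ ((![0, 6, 10, 19] : Fin 4 → ℕ) l) • (S l).map C))).roots.toFinset.filter (fun t => 0 < t)).card ≤ 17 := by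
  have hd : StrictMono (![0, 6, 10, 19] : Fin 4 → ℕ) := by
    refine Fin.strictMono_iff_lt_succ.2 fun j => ?_
    fin_cases j <;> decide
  have hρ : ((({0, 6, 10, 12, 16, 18, 19, 20, 22, 25, 26, 29, 30, 31, 35, 38, 39, 44, 48} : Finset ℕ)).filter (· < 2 * (![0, 6, 10, 19] : Fin 4 → ℕ) 2 + (![0, 6, 10, 19] : Fin 4 → ℕ) 3)).card = 16 := by
    decide
  refine card_posRoots_le_17_of_semidef_nappeTest _ hd S hS h3 hpsd (fun e => ((({0, 6, 10, 12, 16, 18, 19, 20, 22, 25, 26, 29, 30, 31, 35, 38, 39, 44, 48} : Finset ℕ)).filter (· < e)).card) (fun e => by rw [sheetExponents_0_6_10_19])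
    (x := 2) (y := 0) (z := 1) (by decide) (by decide) (by decide) (by decide) ?_ (by decide) (by decide) (by decide) (by decide)
  rw [hρ]; norm_num; exact hor

/-- The `19` sheet exponents of `(0, 6, 8, 13)`. [folklore] -/
theorem sheetExponents_0_6_8_13 :
    (((Finset.univ : Finset (Sym (Fin 4) 3)).erase (Sym.replicate 3 3)).image
        (fun s : Sym (Fin 4) 3 => ((s : Multiset (Fin 4)).map (![0, 6, 8, 13] : Fin 4 → ℕ)).sum))
      = ({0, 6, 8, 12, 13, 14, 16, 18, 19, 20, 21, 22, 24, 25, 26, 27, 29, 32, 34} : Finset ℕ) := by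
  decide

/-- **`(0, 6, 8, 13)`, S₃ ⪯ 0 ∧ det S₀ > 0 ⇒ `Z₊ ≤ 17`** (nappe test: hidden-definite letter `1`, pair `{0, 3}`; ranks by `decide`). [folklore] -/
theorem card_posRoots_le_17_of_semidef_nappeTest_neg_on_0_6_8_13 (S : Fin 4 → Matrix (Fin 3) (Fin 3) ℝ) (hS : ∀ l, (S l).IsSymm)
    (h3 : (S 3).det = 0) (hnsd : (-(S 3)).PosSemidef) (hor : 0 < (S 0).det) :
    ((Matrix.det (∑ l, ((X : ℝ[X]) ^ ((![0, 6, 8, 13] : Fin 4 → ℕ) l) • (S l).map C))).roots.toFinset.filter (fun t => 0 < t)).card ≤ 17 := by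
  have hd : StrictMono (![0, 6, 8, 13] : Fin 4 → ℕ) := by
    refine Fin.strictMono_iff_lt_succ.2 fun j => ?_
    fin_cases j <;> decide
  have hρ : ((({0, 6, 8, 12, 13, 14, 16, 18, 19, 20, 21, 22, 24, 25, 26, 27, 29, 32, 34} : Finset ℕ)).filter (· < 2 * (![0, 6, 8, 13] : Fin 4 → ℕ) 1 + (![0, 6, 8, 13] : Fin 4 → ℕ) 3)).card = 13 := by
    decide
  refine card_posRoots_le_17_of_semidef_nappeTest_neg _ hd S hS h3 hnsd (fun e => ((({0, 6, 8, 12, 13, 14, 16, 18, 19, 20, 21, 22, 24, 25, 26, 27, 29, 32, 34} : Finset ℕ)).filter (· < e)).card) (fun e => by rw [sheetExponents_0_6_8_13])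
    (x := 1) (y := 0) (z := 3) (by decide) (by decide) (by decide) (by decide) ?_ (by decide) (by decide) (by decide) (by decide)
  rw [hρ]; norm_num; exact hor

/-- The `19` sheet exponents of `(0, 7, 16, 20)`. [folklore] -/
theorem sheetExponents_0_7_16_20 :
    (((Finset.univ : Finset (Sym (Fin 4) 3)).erase (Sym.replicate 3 3)).image
        (fun s : Sym (Fin 4) 3 => ((s : Multiset (Fin 4)).map (![0, 7, 16, 20] : Fin 4 → ℕ)).sum))
      = ({0, 7, 14, 16, 20, 21, 23, 27, 30, 32, 34, 36, 39, 40, 43, 47, 48, 52, 56} : Finset ℕ) := by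
  decide

/-- **`(0, 7, 16, 20)`, S₃ ⪯ 0 ∧ det S₀ > 0 ⇒ `Z₊ ≤ 17`** (nappe test: hidden-definite letter `2`, pair `{1, 3}`; ranks by `decide`). [folklore] -/
theorem card_posRoots_le_17_of_semidef_nappeTest_neg_on_0_7_16_20 (S : Fin 4 → Matrix (Fin 3) (Fin 3) ℝ) (hS : ∀ l, (S l).IsSymm)
    (h3 : (S 3).det = 0) (hnsd : (-(S 3)).PosSemidef) (hor : 0 < (S 0).det) :
    ((Matrix.det (∑ l, ((X : ℝ[X]) ^ ((![0, 7, 16, 20] : Fin 4 → ℕ) l) • (S l).map C))).roots.toFinset.filter (fun t => 0 < t)).card ≤ 17 := by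
  have hd : StrictMono (![0, 7, 16, 20] : Fin 4 → ℕ) := by
    refine Fin.strictMono_iff_lt_succ.2 fun j => ?_
    fin_cases j <;> decide
  have hρ : ((({0, 7, 14, 16, 20, 21, 23, 27, 30, 32, 34, 36, 39, 40, 43, 47, 48, 52, 56} : Finset ℕ)).filter (· < 2 * (![0, 7, 16, 20] : Fin 4 → ℕ) 2 + (![0, 7, 16, 20] : Fin 4 → ℕ) 3)).card = 17 := by
    decide
  refine card_posRoots_le_17_of_semidef_nappeTest_neg _ hd S hS h3 hnsd (fun e => ((({0, 7, 14, 16, 20, 21, 23, 27, 30, 32, 34, 36, 39, 40, 43, 47, 48, 52, 56} : Finset ℕ)).filter (· < e)).card) (fun e => by rw [sheetExponents_0_7_16_20])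
    (x := 2) (y := 1) (z := 3) (by decide) (by decide) (by decide) (by decide) ?_ (by decide) (by decide) (by decide) (by decide)
  rw [hρ]; norm_num; exact hor

end Summit.ValiantsHypothesis.ValiantsHypothesis.Theorems.LacunarySymmetroidMatrixDescartes.Census
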